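import Summits.AtomisticToContinuum.Crystallization.Theorems.ExcessDecayLiouvilleHcpLiouvilleBlowdownSecantRows

/-!
# `ExcessDecayLiouville.HcpLiouville` (stmt-AtomisticToContinuum-9332), line `Sketch` (skeleton v4): stub `stub_caccioppoli`

Interface (C) of the blow-down, `Blowdown.CaccioppoliProp ρ C`: the nonlinear Caccioppoli inequality with a COMMON
constant subtracted, from ray-secant coercivity `SecantCoercive ρ κ₁` (`0 < κ₁`).  In the anchored setting
(`S* = Sites₀ (anchorDatum t τ) A`, `v = LevelOne.vField t A τ u`, `χ = LevelOne.cutoff S* c R'`, `‖m‖ ≤ 1`), with the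
row book-keeping of `…HcpLiouvilleBlowdownSecantRows.lean`:

* `Blowdown.sum_sq_mul_weight_le` —
  `Σ_p ‖v p − m‖² Σ_q (χ_p − χ_q)² k(p,q) ≤ 2K₀R'⁻²·oscAt S* v c (3R') m + 310·K₀R'⁻²`
  (near rows `≤ 2K₀/R'²` by the Lipschitz bound of the cut-off; far rows see only the `≤ 32(2R')³` sites of
  `B_{2R'}(c)`, each column `≤ K₀/R'⁵`, against `‖v − m‖² ≤ 121/100`);
* `Blowdown.secFormAt_cutoff_sub_le` — `secFormAt (anchorDatum t τ) A v (χ•(v − m)) ≤` the same bound (row identity,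
  summation by parts, `ab ≤ (a² + b²)/2` and the symmetry of the weight `(χ_p − χ_q)² k(p,q)` for the `b²`-half);
* `Blowdown.nnForm_cutoff_sub_le` — coercivity on the finitely supported test field `χ•(v − m)`;
* `Blowdown.nnEnergy_le_nnForm` — read-out: `nnEnergy S* v c R ≤ nnForm (χ•(v − m))` once `R + 11/10 ≤ R'`;
* `stub_caccioppoli` — cut-off radius `R' = 4R/3` for `R ≥ 4` (`3R' = 4R`), `R' = R + 2` and the counting bound
  `oscAt(3R') ≤ (121/100)·32·18³` for `1 ≤ R < 4`; `C = 230000·K₀/κ₁`.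

All `[folklore]`; a `--supports` helper for item stmt-AtomisticToContinuum-9332, nothing here closes an item.
-/
noncomputable section

namespace Summit.AtomisticToContinuum.Crystallization.Theorems.ExcessDecayLiouville

open scoped BigOperators Topology Classical InnerProductSpace RealInnerProductSpace
open Literature.MathematicalPhysics.StatisticalMechanics
open Summit.AtomisticToContinuum.Crystallization.Theses.ExcessDecayLiouville
open Summit.AtomisticToContinuum.Crystallization.Theorems.PhononStabilityNegative


namespace Blowdown

open LevelOne

variable {t : Fin 2 → (EuclideanSpace ℝ (Fin 3))} {A : (EuclideanSpace ℝ (Fin 3)) →L[ℝ] (EuclideanSpace ℝ (Fin 3))} {τ : (EuclideanSpace ℝ (Fin 3))} {X : Set (EuclideanSpace ℝ (Fin 3))} {u : (EuclideanSpace ℝ (Fin 3)) → (EuclideanSpace ℝ (Fin 3))}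

/-! ## The weighted kernel energy of the cut-off against `‖v − m‖²` -/

/-- **Key finite bound**: for every finite set `F` of anchored sites and `R ≥ 1`,
`Σ_{p ∈ F} ‖v p − m‖² Σ_q (χ_p − χ_q)² k(p,q) ≤ 2K₀R⁻²·oscAt S* v c (3R) m + 310·K₀R⁻²`
(near rows `dist p c ≤ 3R`: row `≤ 2K₀/R²`; far rows: `‖v p − m‖² ≤ 121/100` and the rows see only the
`≤ 32(2R)³` sites of `B_{2R}(c)`, each column `≤ K₀/R⁵`). [folklore] -/
theorem sum_sq_mul_weight_le (hA : Adm₀ A) (hI : Inner₀ t A) (hIτ : Inner₀ (anchorDatum t τ) A)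
    (hu : IsDisplacement X t A u) {m : (EuclideanSpace ℝ (Fin 3))} (hm : ‖m‖ ≤ 1) (c : (EuclideanSpace ℝ (Fin 3))) {R : ℝ} (hR : 1 ≤ R)
    (F : Finset (Sites₀ (anchorDatum t τ) A)) :
    ∑ p ∈ F, ‖vField t A τ u p - m‖ ^ 2 * ∑' q : Sites₀ (anchorDatum t τ) A,
        (cutoff (Sites₀ (anchorDatum t τ) A) c R p - cutoff (Sites₀ (anchorDatum t τ) A) c R q) ^ 2 * ker p q ≤
      2 * K₀ * (R⁻¹) ^ 2 * oscAt (Sites₀ (anchorDatum t τ) A) (vField t A τ u) c (3 * R) m +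
        310 * K₀ * (R⁻¹) ^ 2 := by
  have hR0 : 0 < R := by linarith
  have hK := K₀_pos
  revert F
  set S' := Sites₀ (anchorDatum t τ) A with hS'
  set v := vField t A τ u with hv
  set P := (finite_sites_ball hA hIτ c (2 * R)).toFinset with hP
  have hmemP : ∀ q : S', q ∈ P ↔ dist (q : (EuclideanSpace ℝ (Fin 3))) c ≤ 2 * R := fun q => by
    rw [hP, Set.Finite.mem_toFinset]; rfl
  set w : S' → ℝ := fun p => ∑' q : S', (cutoff S' c R p - cutoff S' c R q) ^ 2 * ker p q with hw
  intro F
  rw [← Finset.sum_filter_add_sum_filter_not F (fun p : S' => dist (p : (EuclideanSpace ℝ (Fin 3))) c ≤ 3 * R)]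
  -- near rows
  have hnear : ∑ p ∈ F.filter (fun p : S' => dist (p : (EuclideanSpace ℝ (Fin 3))) c ≤ 3 * R), ‖v p - m‖ ^ 2 * w p ≤
      2 * K₀ * (R⁻¹) ^ 2 * oscAt S' v c (3 * R) m := by
    have h1 : ∑ p ∈ F.filter (fun p : S' => dist (p : (EuclideanSpace ℝ (Fin 3))) c ≤ 3 * R), ‖v p - m‖ ^ 2 * w p ≤
        ∑ p ∈ F.filter (fun p : S' => dist (p : (EuclideanSpace ℝ (Fin 3))) c ≤ 3 * R), ‖v p - m‖ ^ 2 * (2 * K₀ / R ^ 2) :=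
      Finset.sum_le_sum fun p _ => mul_le_mul_of_nonneg_left (tsum_weight_le hA hIτ c hR p.2) (sq_nonneg _)
    have h2 : ∑ p ∈ F.filter (fun p : S' => dist (p : (EuclideanSpace ℝ (Fin 3))) c ≤ 3 * R), ‖v p - m‖ ^ 2 ≤ oscAt S' v c (3 * R) m := by
      rw [oscAt_eq_tsum_ite, Finset.sum_filter]
      refine (summable_of_ne_finset_zero (s := (finite_sites_ball hA hIτ c (3 * R)).toFinset) ?_).sum_le_tsum F
        fun p _ => by split_ifs <;> positivity
      intro p hp
      exact if_neg fun h => hp ((Set.Finite.mem_toFinset _).2 h)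
    have h3 : 2 * K₀ / R ^ 2 = 2 * K₀ * (R⁻¹) ^ 2 := by rw [inv_pow, div_eq_mul_inv]
    rw [← Finset.sum_mul, h3] at h1
    have h4 : 0 ≤ 2 * K₀ * (R⁻¹) ^ 2 := by positivity
    calc _ ≤ (∑ p ∈ F.filter (fun p : S' => dist (p : (EuclideanSpace ℝ (Fin 3))) c ≤ 3 * R), ‖v p - m‖ ^ 2) * (2 * K₀ * (R⁻¹) ^ 2) := h1
      _ ≤ oscAt S' v c (3 * R) m * (2 * K₀ * (R⁻¹) ^ 2) := mul_le_mul_of_nonneg_right h2 h4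
      _ = _ := mul_comm _ _
  -- far rows
  have hfar : ∑ p ∈ F.filter (fun p : S' => ¬ dist (p : (EuclideanSpace ℝ (Fin 3))) c ≤ 3 * R), ‖v p - m‖ ^ 2 * w p ≤
      121 / 100 * (32 * (2 * R) ^ 3 * (K₀ / R ^ 5)) := by
    calc ∑ p ∈ F.filter (fun p : S' => ¬ dist (p : (EuclideanSpace ℝ (Fin 3))) c ≤ 3 * R), ‖v p - m‖ ^ 2 * w p
        ≤ ∑ p ∈ F.filter (fun p : S' => ¬ dist (p : (EuclideanSpace ℝ (Fin 3))) c ≤ 3 * R),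
            121 / 100 * ∑ q ∈ P, (if R ≤ dist (p : (EuclideanSpace ℝ (Fin 3))) (q : (EuclideanSpace ℝ (Fin 3))) then ker (q : (EuclideanSpace ℝ (Fin 3))) p else 0) := by
          refine Finset.sum_le_sum fun p hp => ?_
          have hpc : 3 * R < dist (p : (EuclideanSpace ℝ (Fin 3))) c := not_le.1 (Finset.mem_filter.1 hp).2
          have hW := tsum_weight_far_le hA hIτ c hR0 hpc
          have hx2 := sq_norm_vField_sub_const_le hA hI hIτ hu hm p.2
          have hW0 : 0 ≤ w p := tsum_nonneg fun q => mul_nonneg (sq_nonneg _) (ker_nonneg _ _)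
          calc ‖v p - m‖ ^ 2 * w p ≤ 121 / 100 * w p := mul_le_mul_of_nonneg_right hx2 hW0
            _ ≤ _ := mul_le_mul_of_nonneg_left hW (by norm_num)
      _ = 121 / 100 * ∑ q ∈ P, ∑ p ∈ F.filter (fun p : S' => ¬ dist (p : (EuclideanSpace ℝ (Fin 3))) c ≤ 3 * R),
            (if R ≤ dist (p : (EuclideanSpace ℝ (Fin 3))) (q : (EuclideanSpace ℝ (Fin 3))) then ker (q : (EuclideanSpace ℝ (Fin 3))) p else 0) := by
          rw [← Finset.mul_sum, Finset.sum_comm]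
      _ ≤ 121 / 100 * ∑ q ∈ P, K₀ / R ^ 5 :=
          mul_le_mul_of_nonneg_left (Finset.sum_le_sum fun q _ => sum_ker_far_le_K₀ hA hIτ (q : (EuclideanSpace ℝ (Fin 3))) hR _)
            (by norm_num)
      _ = 121 / 100 * (P.card * (K₀ / R ^ 5)) := by rw [Finset.sum_const, nsmul_eq_mul]
      _ ≤ 121 / 100 * (32 * (2 * R) ^ 3 * (K₀ / R ^ 5)) := by
          have hcard : (P.card : ℝ) ≤ 32 * (2 * R) ^ 3 :=
            card_sites_le hA hIτ c (by linarith) P fun q hq => (hmemP q).1 hq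
          have h0 : 0 ≤ K₀ / R ^ 5 := by positivity
          exact mul_le_mul_of_nonneg_left (mul_le_mul_of_nonneg_right hcard h0) (by norm_num)
  have h2 : 32 * (2 * R) ^ 3 * (K₀ / R ^ 5) = 256 * K₀ * (R⁻¹) ^ 2 := by
    field_simp
    ring
  rw [h2] at hfar
  have h5 : 0 ≤ K₀ * (R⁻¹) ^ 2 := by positivity
  linarith

/-- **The second part summed over finitely many rows is `≤ 2K₀R⁻²·oscAt(3R) + 310·K₀R⁻²`**
(`ab ≤ (a² + b²)/2`, the `b²`-half re-summed column-wise by the symmetry of `(χ_p − χ_q)² k(p,q)`). [folklore] -/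
theorem sum_T_sub_le (hA : Adm₀ A) (hI : Inner₀ t A) (hIτ : Inner₀ (anchorDatum t τ) A)
    (hu : IsDisplacement X t A u) {m : (EuclideanSpace ℝ (Fin 3))} (hm : ‖m‖ ≤ 1) (c : (EuclideanSpace ℝ (Fin 3))) {R : ℝ} (hR : 1 ≤ R)
    (F : Finset (Sites₀ (anchorDatum t τ) A)) :
    ∑ p ∈ F, ∑' q : Sites₀ (anchorDatum t τ) A,
        (cutoff (Sites₀ (anchorDatum t τ) A) c R p - cutoff (Sites₀ (anchorDatum t τ) A) c R q) ^ 2 *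
          secK (p - q) (vField t A τ u p - vField t A τ u q) (vField t A τ u p - m) (vField t A τ u q - m) ≤
      2 * K₀ * (R⁻¹) ^ 2 * oscAt (Sites₀ (anchorDatum t τ) A) (vField t A τ u) c (3 * R) m +
        310 * K₀ * (R⁻¹) ^ 2 := by
  have hK := K₀_pos
  have hkey := sum_sq_mul_weight_le hA hI hIτ hu hm c hR
  revert F
  set S' := Sites₀ (anchorDatum t τ) A with hS'
  set v := vField t A τ u with hv
  set Bd := 2 * K₀ * (R⁻¹) ^ 2 * oscAt S' v c (3 * R) m + 310 * K₀ * (R⁻¹) ^ 2 with hBd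
  have hB : 0 ≤ Bd := by have := oscAt_nonneg S' v c (3 * R) m; positivity
  intro F
  have h1 := Finset.sum_le_sum fun p (_ : p ∈ F) => (le_abs_self _).trans (abs_T_sub_le_half hA hI hIτ hu hm c R p.2)
  have h2 : ∑ p ∈ F, ∑' q : S', (cutoff S' c R p - cutoff S' c R q) ^ 2 * ker p q * ‖v q - m‖ ^ 2 ≤ Bd := by
    rw [← Summable.tsum_finsetSum fun p _ => summable_weight_mul_sq hA hI hIτ hu hm c R p.2]
    refine tsum_le_of_sum_le' hB fun G => ?_
    calc ∑ q ∈ G, ∑ p ∈ F, (cutoff S' c R p - cutoff S' c R q) ^ 2 * ker p q * ‖v q - m‖ ^ 2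
        = ∑ q ∈ G, ‖v q - m‖ ^ 2 * ∑ p ∈ F, (cutoff S' c R q - cutoff S' c R p) ^ 2 * ker q p := by
          refine Finset.sum_congr rfl fun q _ => ?_
          rw [Finset.mul_sum]
          refine Finset.sum_congr rfl fun p _ => ?_
          rw [ker_comm (p : (EuclideanSpace ℝ (Fin 3))) q]
          ring
      _ ≤ ∑ q ∈ G, ‖v q - m‖ ^ 2 * ∑' p : S', (cutoff S' c R q - cutoff S' c R p) ^ 2 * ker q p :=
          Finset.sum_le_sum fun q _ => mul_le_mul_of_nonneg_left
            ((summable_weight hA hIτ c R q.2).sum_le_tsum F fun _ _ => mul_nonneg (sq_nonneg _) (ker_nonneg _ _))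
            (sq_nonneg _)
      _ ≤ Bd := hkey G
  have h3 : ∑ p ∈ F, (‖v p - m‖ ^ 2 * ∑' q : S', (cutoff S' c R p - cutoff S' c R q) ^ 2 * ker p q +
      ∑' q : S', (cutoff S' c R p - cutoff S' c R q) ^ 2 * ker p q * ‖v q - m‖ ^ 2) / 2 =
      (∑ p ∈ F, ‖v p - m‖ ^ 2 * ∑' q : S', (cutoff S' c R p - cutoff S' c R q) ^ 2 * ker p q +
        ∑ p ∈ F, ∑' q : S', (cutoff S' c R p - cutoff S' c R q) ^ 2 * ker p q * ‖v q - m‖ ^ 2) / 2 := by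
    rw [← Finset.sum_add_distrib, Finset.sum_div]
  rw [h3] at h1
  have h4 := hkey F
  linarith

/-! ## The nonlinear Caccioppoli inequality with a common constant (secant form) -/

/-- **Nonlinear Caccioppoli inequality, secant form, common constant subtracted**: for `R ≥ 1`, every centre `c`
and every `‖m‖ ≤ 1`,
`secFormAt (anchorDatum t τ) A v (χ•(v − m)) ≤ 2K₀R⁻²·oscAt S* v c (3R) m + 310·K₀R⁻²`, `χ = cutoff S* c R`.
[folklore] -/
theorem secFormAt_cutoff_sub_le (hA : Adm₀ A) (hI : Inner₀ t A) (hIτ : Inner₀ (anchorDatum t τ) A)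
    (hu : IsDisplacement X t A u) (hEX : Equil₀ X) (hEτ : Equil₀ (Sites₀ (anchorDatum t τ) A))
    (c : (EuclideanSpace ℝ (Fin 3))) {R : ℝ} (hR : 1 ≤ R) {m : (EuclideanSpace ℝ (Fin 3))} (hm : ‖m‖ ≤ 1) :
    secFormAt (anchorDatum t τ) A (vField t A τ u)
        (fun p => cutoff (Sites₀ (anchorDatum t τ) A) c R p • (vField t A τ u p - m)) ≤
      2 * K₀ * (R⁻¹) ^ 2 * oscAt (Sites₀ (anchorDatum t τ) A) (vField t A τ u) c (3 * R) m +
        310 * K₀ * (R⁻¹) ^ 2 := by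
  have hR0 : 0 < R := by linarith
  rw [secFormAt_eq_tsum hA hI hIτ hu]
  have hrows : ∀ p : Sites₀ (anchorDatum t τ) A,
      ∑' q : Sites₀ (anchorDatum t τ) A, secK (p - q) (vField t A τ u p - vField t A τ u q)
        ((fun x => cutoff (Sites₀ (anchorDatum t τ) A) c R x • (vField t A τ u x - m)) p -
          (fun x => cutoff (Sites₀ (anchorDatum t τ) A) c R x • (vField t A τ u x - m)) q)
        ((fun x => cutoff (Sites₀ (anchorDatum t τ) A) c R x • (vField t A τ u x - m)) p -
          (fun x => cutoff (Sites₀ (anchorDatum t τ) A) c R x • (vField t A τ u x - m)) q) =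
      -(∑' q : Sites₀ (anchorDatum t τ) A,
          secK (p - q) (vField t A τ u p - vField t A τ u q) (vField t A τ u p - vField t A τ u q)
            (cutoff (Sites₀ (anchorDatum t τ) A) c R q ^ 2 • (vField t A τ u q - m))) +
        ∑' q : Sites₀ (anchorDatum t τ) A,
          (cutoff (Sites₀ (anchorDatum t τ) A) c R p - cutoff (Sites₀ (anchorDatum t τ) A) c R q) ^ 2 *
            secK (p - q) (vField t A τ u p - vField t A τ u q) (vField t A τ u p - m) (vField t A τ u q - m) :=
    fun p => row_identity_sub hA hI hIτ hu hEX hEτ c R hm p.2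
  rw [tsum_congr hrows, Summable.tsum_add (summable_first_part_sub hA hI hIτ hu hm c hR0).neg
    (summable_T_sub hA hI hIτ hu hm c hR0), tsum_neg, tsum_first_part_sub_eq_zero hA hI hIτ hu hEX hEτ hm c hR0,
    neg_zero, zero_add]
  exact (summable_T_sub hA hI hIτ hu hm c hR0).tsum_le_of_sum_le (sum_T_sub_le hA hI hIτ hu hm c hR)

/-! ## The test field `χ • (v − m)` is admissible for the coercivity hypothesis -/

/-- The test field `χ•(v − m)` is finitely supported inside the anchored sites. [folklore] -/
theorem support_cutoff_smul_sub (hA : Adm₀ A) (hIτ : Inner₀ (anchorDatum t τ) A) (c : (EuclideanSpace ℝ (Fin 3))) {R : ℝ} (hR : 0 < R)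
    (u : (EuclideanSpace ℝ (Fin 3)) → (EuclideanSpace ℝ (Fin 3))) (m : (EuclideanSpace ℝ (Fin 3))) :
    (Function.support fun p => cutoff (Sites₀ (anchorDatum t τ) A) c R p • (vField t A τ u p - m)).Finite ∧
      (Function.support fun p => cutoff (Sites₀ (anchorDatum t τ) A) c R p • (vField t A τ u p - m)) ⊆
        Sites₀ (anchorDatum t τ) A := by
  have hsub : (Function.support fun p => cutoff (Sites₀ (anchorDatum t τ) A) c R p • (vField t A τ u p - m)) ⊆
      {s | s ∈ Sites₀ (anchorDatum t τ) A ∧ dist s c ≤ 2 * R} := by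
    intro p hp
    rw [Function.mem_support] at hp
    have hχ : cutoff (Sites₀ (anchorDatum t τ) A) c R p ≠ 0 := fun h => hp (by rw [h, zero_smul])
    obtain ⟨hpS, hd⟩ := mem_of_cutoff_ne_zero hR hχ
    exact ⟨hpS, hd.le⟩
  exact ⟨(finite_sites_dist_le hA hIτ c (2 * R)).subset hsub, fun p hp => (hsub hp).1⟩

/-- **Coercivity applied to the cut-off field `χ•(v − m)`**:
`κ₁·nnForm (anchorDatum t τ) A (χ•(v − m)) ≤ K₀R⁻²·oscAt S* v c (3R) m + 155·K₀R⁻²`. [folklore] -/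
theorem nnForm_cutoff_sub_le {ρ κ₁ : ℝ} (hSC : SecantCoercive ρ κ₁) (hA : Adm₀ A) (hI : Inner₀ t A)
    (hρ : ‖τ‖ ≤ ρ) (hIτ : Inner₀ (anchorDatum t τ) A) (hEτ : Equil₀ (Sites₀ (anchorDatum t τ) A))
    (hu : IsDisplacement X t A u) (hEX : Equil₀ X) (c : (EuclideanSpace ℝ (Fin 3))) {R : ℝ} (hR : 1 ≤ R) {m : (EuclideanSpace ℝ (Fin 3))} (hm : ‖m‖ ≤ 1) :
    κ₁ * nnForm (anchorDatum t τ) A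
        (fun p => cutoff (Sites₀ (anchorDatum t τ) A) c R p • (vField t A τ u p - m)) ≤
      K₀ * (R⁻¹) ^ 2 * oscAt (Sites₀ (anchorDatum t τ) A) (vField t A τ u) c (3 * R) m + 155 * K₀ * (R⁻¹) ^ 2 := by
  have hbox : ∀ s ∈ Sites₀ (anchorDatum t τ) A, ‖vField t A τ u s + shiftField (anchorDatum t τ) A τ s‖ ≤ 1 / 40 :=
    fun s hs => by rw [vField_add_shiftField]; exact hu.1 _ (bwd_mem hA hIτ hs)
  obtain ⟨hfin, hsub⟩ := support_cutoff_smul_sub hA hIτ c (by linarith : (0 : ℝ) < R) u m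
  have h := hSC t A τ hA hI hρ hIτ hEτ (vField t A τ u) hbox _ hfin hsub
  have h2 := secFormAt_cutoff_sub_le hA hI hIτ hu hEX hEτ c hR hm
  have h3 := div_le_div_of_nonneg_right h2 (by norm_num : (0 : ℝ) ≤ 2)
  refine (h.trans h3).trans (le_of_eq ?_)
  ring

/-! ## Read-out: the strain energy on the ball from `nnForm` of the cut-off field -/


/-- **Read-out**: if `R + 11/10 ≤ R'` then `nnEnergy S* v c R ≤ nnForm (anchorDatum t τ) A (χ'•(v − m))` with
`χ' = cutoff S* c R'` (`χ' = 1` at both ends of every bond counted on the left). [folklore] -/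
theorem nnEnergy_le_nnForm (hA : Adm₀ A) (hIτ : Inner₀ (anchorDatum t τ) A) (u : (EuclideanSpace ℝ (Fin 3)) → (EuclideanSpace ℝ (Fin 3))) (c m : (EuclideanSpace ℝ (Fin 3)))
    {R R' : ℝ} (hR' : 0 < R') (hRR' : R + 11 / 10 ≤ R') :
    nnEnergy (Sites₀ (anchorDatum t τ) A) (vField t A τ u) c R ≤
      nnForm (anchorDatum t τ) A (fun p => cutoff (Sites₀ (anchorDatum t τ) A) c R' p • (vField t A τ u p - m)) := by
  rw [nnEnergy_eq_tsum_ite]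
  set φ : (EuclideanSpace ℝ (Fin 3)) → (EuclideanSpace ℝ (Fin 3)) := fun p => cutoff (Sites₀ (anchorDatum t τ) A) c R' p • (vField t A τ u p - m) with hφ
  have hφ1 : ∀ p ∈ Sites₀ (anchorDatum t τ) A, dist p c ≤ R' → φ p = vField t A τ u p - m := fun p hp hd => by
    simp only [hφ, cutoff_eq_one hR' hp hd, one_smul]
  have hφ0 : ∀ p : (EuclideanSpace ℝ (Fin 3)), 2 * R' ≤ dist p c → φ p = 0 := fun p hd => by
    simp only [hφ, cutoff_eq_zero_of_le hR' hd, zero_smul]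
  unfold nnForm
  refine Summable.tsum_le_tsum (fun p => ?_) ?_ ?_
  · by_cases hpc : dist (p : (EuclideanSpace ℝ (Fin 3))) c ≤ R
    · rw [if_pos hpc]
      refine (tsum_congr fun q => ?_).le
      by_cases hd : dist (p : (EuclideanSpace ℝ (Fin 3))) q ≤ 11 / 10
      · have h4 := dist_triangle (q : (EuclideanSpace ℝ (Fin 3))) p c
        rw [dist_comm (q : (EuclideanSpace ℝ (Fin 3))) p] at h4
        rw [if_pos hd, if_pos hd, hφ1 _ p.2 (by linarith), hφ1 _ q.2 (by linarith), sub_sub_sub_cancel_right]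
      · rw [if_neg hd, if_neg hd]
    · rw [if_neg hpc]
      exact tsum_nonneg fun q => by split_ifs <;> positivity
  · refine summable_of_ne_finset_zero (s := (finite_sites_ball hA hIτ c R).toFinset) fun p hp => ?_
    exact if_neg fun h => hp ((Set.Finite.mem_toFinset _).2 h)
  · refine summable_of_ne_finset_zero (s := (finite_sites_ball hA hIτ c (2 * R' + 11 / 10)).toFinset)
      fun p hp => ?_
    have hfar : 2 * R' + 11 / 10 < dist (p : (EuclideanSpace ℝ (Fin 3))) c := not_le.1 fun h => hp ((Set.Finite.mem_toFinset _).2 h)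
    have hφp : φ p = 0 := hφ0 _ (by linarith)
    refine (tsum_congr fun q => ?_).trans tsum_zero
    by_cases hd : dist (p : (EuclideanSpace ℝ (Fin 3))) q ≤ 11 / 10
    · have h4 := dist_triangle (p : (EuclideanSpace ℝ (Fin 3))) q c
      have hφq : φ q = 0 := hφ0 _ (by linarith)
      rw [if_pos hd, hφp, hφq, sub_zero, norm_zero]
      norm_num
    · rw [if_neg hd]


/-! ## The estimate at a general cut-off radius -/

/-- **The Caccioppoli estimate at cut-off radius `R'`**: for `1 ≤ R'`, `R + 11/10 ≤ R'`, `‖m‖ ≤ 1`,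
`κ₁·nnEnergy S* v c R ≤ K₀R'⁻²·oscAt S* v c (3R') m + 155·K₀R'⁻²`. [folklore] -/
theorem nnEnergy_le_main {ρ κ₁ : ℝ} (hSC : SecantCoercive ρ κ₁) (hκ₁ : 0 ≤ κ₁) (hA : Adm₀ A) (hI : Inner₀ t A)
    (hρ : ‖τ‖ ≤ ρ) (hIτ : Inner₀ (anchorDatum t τ) A) (hEτ : Equil₀ (Sites₀ (anchorDatum t τ) A))
    (hu : IsDisplacement X t A u) (hEX : Equil₀ X) (c : (EuclideanSpace ℝ (Fin 3))) {R R' : ℝ} (hR' : 1 ≤ R') (hRR' : R + 11 / 10 ≤ R')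
    {m : (EuclideanSpace ℝ (Fin 3))} (hm : ‖m‖ ≤ 1) :
    κ₁ * nnEnergy (Sites₀ (anchorDatum t τ) A) (vField t A τ u) c R ≤
      K₀ * (R'⁻¹) ^ 2 * oscAt (Sites₀ (anchorDatum t τ) A) (vField t A τ u) c (3 * R') m + 155 * K₀ * (R'⁻¹) ^ 2 := by
  have h1 := nnEnergy_le_nnForm hA hIτ u c m (by linarith) hRR'
  have h2 := nnForm_cutoff_sub_le hSC hA hI hρ hIτ hEτ hu hEX c hR' hm
  exact (mul_le_mul_of_nonneg_left h1 hκ₁).trans h2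

end Blowdown

/-- **Stub `stub_caccioppoli` (line `Sketch`, skeleton v4, interface (C))**: the nonlinear Caccioppoli inequality with
a common constant subtracted, from ray-secant coercivity — for `R ≥ 4` the cut-off radius `4R/3` (`3·(4R/3) = 4R`),
for `1 ≤ R < 4` the cut-off radius `R + 2` and the counting bound `oscAt(3R + 6) ≤ (121/100)·32·18³`. [folklore] -/
theorem stub_caccioppoli : ∀ ρ κ₁ : ℝ, 0 < κ₁ → SecantCoercive ρ κ₁ → ∃ C : ℝ, Blowdown.CaccioppoliProp ρ C := by
  intro ρ κ₁ hκ₁ hSC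
  refine ⟨230000 * LevelOne.K₀ / κ₁, ?_⟩
  intro X t A u τ hA hI hEX hu hρ hIτ hEτ c R m hR hm
  have hK := LevelOne.K₀_pos
  have hR0 : 0 < R := by linarith
  set N := Blowdown.nnEnergy (Sites₀ (anchorDatum t τ) A) (LevelOne.vField t A τ u) c R with hN
  set O := Blowdown.oscAt (Sites₀ (anchorDatum t τ) A) (LevelOne.vField t A τ u) c (4 * R) m with hO
  have hO0 : 0 ≤ O := Blowdown.oscAt_nonneg _ _ _ _ _
  have hX0 : 0 ≤ (R⁻¹) ^ 2 := by positivity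
  have h7 : 0 ≤ LevelOne.K₀ * (R⁻¹) ^ 2 * O := mul_nonneg (mul_nonneg hK.le hX0) hO0
  have h8 : 0 ≤ LevelOne.K₀ * (R⁻¹) ^ 2 := mul_nonneg hK.le hX0
  have hfin : κ₁ * N ≤ LevelOne.K₀ * (R⁻¹) ^ 2 * O + 226000 * LevelOne.K₀ * (R⁻¹) ^ 2 := by
    by_cases h4 : 4 ≤ R
    · have key := Blowdown.nnEnergy_le_main hSC hκ₁.le hA hI hρ hIτ hEτ hu hEX c (R := R) (R' := 4 * R / 3)
        (by linarith) (by linarith) hm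
      have h3 : 3 * (4 * R / 3) = 4 * R := by ring
      rw [h3] at key
      have hinv : ((4 * R / 3)⁻¹) ^ 2 ≤ (R⁻¹) ^ 2 :=
        pow_le_pow_left₀ (inv_nonneg.2 (by positivity)) (inv_anti₀ hR0 (by linarith)) 2
      have h5 : LevelOne.K₀ * ((4 * R / 3)⁻¹) ^ 2 * O ≤ LevelOne.K₀ * (R⁻¹) ^ 2 * O :=
        mul_le_mul_of_nonneg_right (mul_le_mul_of_nonneg_left hinv hK.le) hO0
      have h6 : 155 * LevelOne.K₀ * ((4 * R / 3)⁻¹) ^ 2 ≤ 155 * LevelOne.K₀ * (R⁻¹) ^ 2 :=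
        mul_le_mul_of_nonneg_left hinv (by positivity)
      linarith
    · push Not at h4
      have key := Blowdown.nnEnergy_le_main hSC hκ₁.le hA hI hρ hIτ hEτ hu hEX c (R := R) (R' := R + 2)
        (by linarith) (by linarith) hm
      have hosc : Blowdown.oscAt (Sites₀ (anchorDatum t τ) A) (LevelOne.vField t A τ u) c (3 * (R + 2)) m ≤
          121 / 100 * (32 * (3 * (R + 2)) ^ 3) :=
        Blowdown.oscAt_le_of_sq_le hA hIτ _ (fun p hp => Blowdown.sq_norm_vField_sub_const_le hA hI hIτ hu hm hp)
          (by norm_num) c (by linarith)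
      have hcube : (3 * (R + 2)) ^ 3 ≤ (18 : ℝ) ^ 3 := pow_le_pow_left₀ (by linarith) (by linarith) 3
      have hY0 : 0 ≤ ((R + 2)⁻¹) ^ 2 := by positivity
      have hinv : ((R + 2)⁻¹) ^ 2 ≤ (R⁻¹) ^ 2 :=
        pow_le_pow_left₀ (inv_nonneg.2 (by linarith)) (inv_anti₀ hR0 (by linarith)) 2
      have hosc' : Blowdown.oscAt (Sites₀ (anchorDatum t τ) A) (LevelOne.vField t A τ u) c (3 * (R + 2)) m ≤
          225816 := by nlinarith
      have h9 : LevelOne.K₀ * ((R + 2)⁻¹) ^ 2 *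
          Blowdown.oscAt (Sites₀ (anchorDatum t τ) A) (LevelOne.vField t A τ u) c (3 * (R + 2)) m ≤
          LevelOne.K₀ * ((R + 2)⁻¹) ^ 2 * 225816 :=
        mul_le_mul_of_nonneg_left hosc' (mul_nonneg hK.le hY0)
      have h10 : LevelOne.K₀ * ((R + 2)⁻¹) ^ 2 ≤ LevelOne.K₀ * (R⁻¹) ^ 2 := mul_le_mul_of_nonneg_left hinv hK.le
      linarith
  rw [div_mul_eq_mul_div, le_div_iff₀ hκ₁]
  linarith

end Summit.AtomisticToContinuum.Crystallization.Theorems.ExcessDecayLiouville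

end
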